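import Summits.Langlands.Langlands.Theses.ExtendedAdequacySplit

/-!
# Route ExtendedAdequacySplit — Assembly

The assembly item (stmt-Langlands-26846) of the child route `ExtendedAdequacySplit` (decomp-langlands lens-5 gen 13; refines the declared
residual DEG = `LieDefectSplit.DegenerateLayerLifting`, stmt-Langlands-28416, of route-Langlands-LieDefectSplit) for the Langlands summit: the
curried implication from the route's twelve items (XS, CORE, HIGH, the Odlyzko-world dedup items OW / RES / W⁺ / CSD / RPO / RNO₂ / RNO₃, the
transport T_N and FRAME″) to `Langlands`.

This is literally the type of the route file's sorry-free deciding theorem `Summit.Langlands.Langlands.Theses.ExtendedAdequacySplit.closes`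
(FRAME″ reduces `Langlands` to DEG; the position `n < ℓ` / `ℓ ≤ n` and two excluded middles on the extended-adequacy and core-irreducibility dials
dispatch to HIGH, XS, CORE or, through T_N fed with the seven binders of record, CRD).  Nothing here proves `Langlands`.
-/

set_option linter.dupNamespace false -- project-wide option (lakefile weak.linter.dupNamespace); `Summit.Langlands.Langlands` is the mandated namespace

namespace Summit.Langlands.Langlands.Theorems

/-- **Assembly of route ExtendedAdequacySplit** (stmt-Langlands-26846).  Proof: unfold `Assembly` and apply the route's deciding theorem
`Theses.ExtendedAdequacySplit.closes`. -/
theorem extendedAdequacySplit_assembly_proof :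
    Summit.Langlands.Langlands.Theses.ExtendedAdequacySplit.Assembly := by
  unfold Summit.Langlands.Langlands.Theses.ExtendedAdequacySplit.Assembly
  exact Summit.Langlands.Langlands.Theses.ExtendedAdequacySplit.closes

end Summit.Langlands.Langlands.Theorems
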